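import Literature.Probability.RandomPlanarGeometry.LoewnerDriverStability
import Literature.Probability.RandomPlanarGeometry.LoewnerRealKoebe
import Mathlib.Topology.UniformSpace.CompactConvergence
import HarnessLib

/-!
# Joint continuity of the real Loewner flow in time and driving path, away from the driving point

Topic `Literature/Probability/RandomPlanarGeometry`; theorems only. For the chordal Loewner flow
(`ġ = 2/(g - W)`) and a real point `y`, the frozen real flow seen from the driving point,
`X^y_t(w) = realFlowStop w y t = g_t(y) - w_t` (for `t < T_y`), is a functional of the driving
path `w ∈ C([0, ∞), ℝ)` (compact-open = locally uniform topology).  This file proves that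
`(t, w) ↦ realFlowStop w y t` is JOINTLY CONTINUOUS at `(t₀, w₀)` as soon as the flow of `w₀`
stays a definite distance `m > 0` away from the driving point on a time interval `[0, b]` with
`t₀ < b < T_y(w₀)` — the elementary consequence of the tree's two-driver tube estimate
`Loewner.dist_map_le_of_driving_close` (`LoewnerDriverStability.lean`, Lawler 2005 §4.7) that the
passage of LEVEL-STOPPED boundary observables to the scaling limit needs (before the level stopping
time the mark flows stay above the lower level `m > 0`): for paths `w` uniformly `ω`-close to `w₀`
on `[0, b]`, the mark `y` is still flowing at time `b` and
`|X^y_s(w) - X^y_s(w₀)| ≤ ω e^{8 s/m²}` on `[0, b]`.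

* `norm_map_sub_driving_eq_abs_realFlow` — for a real point alive at time `t`,
  `‖g_t(y) - w_t‖ = |realFlow w y t|` (the Loewner map is real on reals, `map_conj`);
* `abs_realFlowStop_sub_le_of_driving_close` — the tube estimate for the real flows;
* `continuousAt_realFlowStop_driver` — joint continuity of `(t, w) ↦ realFlowStop w y t` at
  `(t₀, w₀)`.

## References

* G. F. Lawler, *Conformally Invariant Processes in the Plane* (2005), Ch. 4, §4.7 (Prop. 4.47).
  [Lawler2005]
-/

noncomputable section

open Set Filter Metric Topology Complex ComplexConjugate
open scoped NNReal Topology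

namespace Literature.Probability.RandomPlanarGeometry

namespace Loewner

/-! ### The Loewner map is real on real points -/

/-- For a real point `y` alive at time `t` under a continuous driving function,
`g_t(y) - W_t` is the real number `realFlow W y t`. [cite: Lawler2005, Ch. 4 §4.1] -/
theorem map_sub_driving_eq_ofReal_realFlow {W : ℝ≥0 → ℝ} (hW : Continuous W) {y : ℝ} {t : ℝ≥0}
    (ht : (t : WithTop ℝ≥0) < swallowingTime W y) :
    map W t y - (W t : ℂ) = ((realFlow W y t : ℝ) : ℂ) := by
  have hconj : map W t y = conj (map W t y) := by
    have h := map_conj (z := (y : ℂ)) hW ht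
    rwa [Complex.conj_ofReal] at h
  have him : (map W t y).im = 0 := by
    have := congrArg Complex.im hconj
    rw [Complex.conj_im] at this
    linarith
  apply Complex.ext
  · simp [realFlow_apply]
  · simp [him]

/-- For a real point alive at time `t`, `‖g_t(y) - W_t‖ = |realFlow W y t|`. [folklore] -/
theorem norm_map_sub_driving_eq_abs_realFlow {W : ℝ≥0 → ℝ} (hW : Continuous W) {y : ℝ}
    {t : ℝ≥0} (ht : (t : WithTop ℝ≥0) < swallowingTime W y) :
    ‖map W t y - (W t : ℂ)‖ = |realFlow W y t| := by
  rw [map_sub_driving_eq_ofReal_realFlow hW ht, Complex.norm_real, Real.norm_eq_abs]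

/-! ### The tube estimate for the real flows -/

/-- **The two-driver tube estimate for the frozen real flows.**  Let `w₀`, `w` be continuous
driving functions, `y` a real point alive at time `b` for `w₀` whose flow stays `m`-away from
the driving point on `[0, b]` (`m ≤ |realFlowStop w₀ y s|`), and `|w - w₀| ≤ ω` on `[0, b]` with
`ω ≤ m/4` and `ω (e^{Kb} - 1) < m/4`, `K = 8/m²`.  Then `y` is alive at time `b` for `w` and
`|realFlowStop w y s - realFlowStop w₀ y s| ≤ ω e^{Ks}` for all `s ≤ b`.
[cite: Lawler2005, Ch. 4 §4.7 (Prop. 4.47)] -/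
theorem abs_realFlowStop_sub_le_of_driving_close {w₀ w : ℝ≥0 → ℝ} (hw₀ : Continuous w₀)
    (hw : Continuous w) {y : ℝ} {b : ℝ≥0} (hb : (b : WithTop ℝ≥0) < swallowingTime w₀ y)
    {m : ℝ≥0} (hm : 0 < m) (hfar : ∀ s : ℝ≥0, s ≤ b → (m : ℝ) ≤ |realFlowStop w₀ y s|)
    {ω : ℝ} (hω0 : 0 ≤ ω) (hωm : ω ≤ m / 4) (hclose : ∀ s : ℝ≥0, s ≤ b → |w₀ s - w s| ≤ ω)
    (hsmall : ω * (Real.exp (2 / ((m : ℝ) / 2) ^ 2 * b) - 1) < m / 4) :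
    (b : WithTop ℝ≥0) < swallowingTime w y ∧
      ∀ s : ℝ≥0, s ≤ b → |realFlowStop w y s - realFlowStop w₀ y s| ≤
        ω * Real.exp (2 / ((m : ℝ) / 2) ^ 2 * s) := by
  -- before `b` both flows are the unfrozen ones and the Loewner map is real
  have halive₀ : ∀ s : ℝ≥0, s ≤ b → (s : WithTop ℝ≥0) < swallowingTime w₀ y := fun s hs ↦
    lt_of_le_of_lt (WithTop.coe_le_coe.2 hs) hb
  have hfar' : ∀ s : ℝ≥0, s ≤ b → (m : ℝ) ≤ ‖map w₀ s y - (w₀ s : ℂ)‖ := by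
    intro s hs
    rw [norm_map_sub_driving_eq_abs_realFlow hw₀ (halive₀ s hs), ← realFlowStop_of_lt (halive₀ s hs)]
    exact hfar s hs
  have hsmall' : dist (y : ℂ) (y : ℂ) * Real.exp (2 / ((m : ℝ) / 2) ^ 2 * b) +
      ω * (Real.exp (2 / ((m : ℝ) / 2) ^ 2 * b) - 1) < m / 4 := by
    rw [dist_self, zero_mul, zero_add]; exact hsmall
  obtain ⟨halive, hdist⟩ := dist_map_le_of_driving_close (z := (y : ℂ)) (z' := (y : ℂ)) hw₀ hw hb
    hm hfar' hω0 hωm hclose hsmall'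
  refine ⟨halive, fun s hs ↦ ?_⟩
  have hs₀ := halive₀ s hs
  have hs₁ : (s : WithTop ℝ≥0) < swallowingTime w y := lt_of_le_of_lt (WithTop.coe_le_coe.2 hs) halive
  have hd := hdist s hs
  rw [dist_self, zero_mul, zero_add] at hd
  -- `X(w) - X(w₀) = (g - g₀) - (w - w₀)` as complex numbers
  have hcx : (((realFlowStop w y s - realFlowStop w₀ y s : ℝ) : ℂ)) =
      (map w s y - map w₀ s y) - ((w s : ℂ) - (w₀ s : ℂ)) := by
    rw [realFlowStop_of_lt hs₁, realFlowStop_of_lt hs₀, Complex.ofReal_sub,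
      ← map_sub_driving_eq_ofReal_realFlow hw hs₁, ← map_sub_driving_eq_ofReal_realFlow hw₀ hs₀]
    ring
  have hnorm : |realFlowStop w y s - realFlowStop w₀ y s| ≤
      dist (map w s y) (map w₀ s y) + |w₀ s - w s| := by
    rw [← Real.norm_eq_abs, ← Complex.norm_real, hcx, dist_eq_norm]
    refine (norm_sub_le _ _).trans (add_le_add le_rfl ?_)
    rw [← Complex.ofReal_sub, Complex.norm_real, Real.norm_eq_abs, abs_sub_comm]
  have hexp : 1 ≤ Real.exp (2 / ((m : ℝ) / 2) ^ 2 * s) := Real.one_le_exp (by positivity)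
  calc |realFlowStop w y s - realFlowStop w₀ y s|
      ≤ ω * (Real.exp (2 / ((m : ℝ) / 2) ^ 2 * s) - 1) + ω := by
        linarith [hnorm, hd, hclose s hs]
    _ = ω * Real.exp (2 / ((m : ℝ) / 2) ^ 2 * s) := by ring

/-! ### Joint continuity in time and driving path -/

/-- Paths near `w₀` in the compact-open topology are uniformly close to `w₀` on `[0, b]`.
[folklore] -/
theorem eventually_forall_abs_sub_le (w₀ : C(ℝ≥0, ℝ)) (b : ℝ≥0) {ω : ℝ} (hω : 0 < ω) :
    ∀ᶠ w : C(ℝ≥0, ℝ) in 𝓝 w₀, ∀ s : ℝ≥0, s ≤ b → |w₀ s - w s| ≤ ω := by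
  have h := (ContinuousMap.tendsto_iff_forall_isCompact_tendstoUniformlyOn.1
    (tendsto_id (x := 𝓝 w₀))) (Icc 0 b) isCompact_Icc
  have h' := (Metric.tendstoUniformlyOn_iff.1 h) ω hω
  filter_upwards [h'] with w hw s hs
  have := hw s ⟨zero_le, hs⟩
  rw [Real.dist_eq] at this
  exact this.le

/-- **Joint continuity of the frozen real flow in time and driving path.**  Let `w₀` be a
continuous driving path and `y` a real point alive at time `b` for `w₀`, whose flow stays
`m`-away from the driving point on `[0, b]` (`0 < m ≤ |realFlowStop w₀ y s|` for `s ≤ b`).  Then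
for every `t₀ < b` the map `(t, w) ↦ realFlowStop w y t` on `ℝ≥0 × C([0, ∞), ℝ)` is continuous at
`(t₀, w₀)`. [cite: Lawler2005, Ch. 4 §4.7 (Prop. 4.47)] -/
theorem continuousAt_realFlowStop_driver {w₀ : C(ℝ≥0, ℝ)} {y : ℝ} {b : ℝ≥0}
    (hb : (b : WithTop ℝ≥0) < swallowingTime w₀ y) {m : ℝ≥0} (hm : 0 < m)
    (hfar : ∀ s : ℝ≥0, s ≤ b → (m : ℝ) ≤ |realFlowStop w₀ y s|) {t₀ : ℝ≥0} (ht₀ : t₀ < b) :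
    ContinuousAt (fun q : ℝ≥0 × C(ℝ≥0, ℝ) ↦ realFlowStop q.2 y q.1) (t₀, w₀) := by
  rw [ContinuousAt, Metric.tendsto_nhds]
  intro ε hε
  -- constants of the tube estimate
  set E : ℝ := Real.exp (2 / ((m : ℝ) / 2) ^ 2 * b) with hE
  have hE1 : 1 ≤ E := Real.one_le_exp (by positivity)
  have hEpos : 0 < E := by positivity
  -- choose `ω > 0` with `ω ≤ m/4`, `ω (E - 1) < m/4`, `ω E < ε/2`
  obtain ⟨ω, hω0, hωm, hωsmall, hωε⟩ : ∃ ω : ℝ, 0 < ω ∧ ω ≤ m / 4 ∧ ω * (E - 1) < m / 4 ∧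
      ω * E < ε / 2 := by
    refine ⟨min (m / 8 / E) (ε / 4 / E), lt_min (by positivity) (by positivity), ?_, ?_, ?_⟩
    · have h1 : min ((m : ℝ) / 8 / E) (ε / 4 / E) ≤ m / 8 / E := min_le_left _ _
      have h2 : (m : ℝ) / 8 / E ≤ m / 8 := div_le_self (by positivity) hE1
      have : (m : ℝ) / 8 ≤ m / 4 := by
        have := hm.le; have hm' : (0 : ℝ) ≤ m := m.coe_nonneg; linarith
      linarith
    · have h1 : min ((m : ℝ) / 8 / E) (ε / 4 / E) * (E - 1) ≤ (m / 8 / E) * (E - 1) :=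
        mul_le_mul_of_nonneg_right (min_le_left _ _) (by linarith)
      have h2 : ((m : ℝ) / 8 / E) * (E - 1) ≤ (m / 8 / E) * E :=
        mul_le_mul_of_nonneg_left (by linarith) (by positivity)
      have h3 : ((m : ℝ) / 8 / E) * E = m / 8 := by field_simp
      have hmpos : (0 : ℝ) < m := by exact_mod_cast hm
      linarith
    · have h1 : min ((m : ℝ) / 8 / E) (ε / 4 / E) * E ≤ (ε / 4 / E) * E :=
        mul_le_mul_of_nonneg_right (min_le_right _ _) hEpos.le
      have h2 : (ε / 4 / E) * E = ε / 4 := by field_simp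
      linarith
  -- continuity in time of the flow of `w₀` at `t₀`
  have hy : y ≠ w₀ 0 := by
    have h := ne_driving_of_lt_swallowingTime (lt_of_le_of_lt bot_le hb : ((0 : ℝ≥0) : WithTop ℝ≥0) < _)
    intro h'; exact h (by rw [h'])
  have hct : ContinuousAt (fun t : ℝ≥0 ↦ realFlowStop w₀ y t) t₀ :=
    (continuous_realFlowStop_of_ne w₀.continuous hy).continuousAt
  have h1 : ∀ᶠ t in 𝓝 t₀, dist (realFlowStop w₀ y t) (realFlowStop w₀ y t₀) < ε / 2 :=
    Metric.tendsto_nhds.1 hct (ε / 2) (half_pos hε)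
  have h2 : ∀ᶠ t in 𝓝 t₀, t < b := Iio_mem_nhds ht₀
  have h3 := eventually_forall_abs_sub_le w₀ b hω0
  filter_upwards [(h1.and h2).prod_nhds h3] with q hq
  obtain ⟨⟨hq1, hq2⟩, hq3⟩ := hq
  have hsmall : ω * (Real.exp (2 / ((m : ℝ) / 2) ^ 2 * b) - 1) < m / 4 := hωsmall
  obtain ⟨-, hest⟩ := abs_realFlowStop_sub_le_of_driving_close (w := q.2) w₀.continuous
    q.2.continuous hb hm hfar hω0.le hωm hq3 hsmall
  have hq1le : q.1 ≤ b := hq2.le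
  have hA := hest q.1 hq1le
  have hexp_le : Real.exp (2 / ((m : ℝ) / 2) ^ 2 * q.1) ≤ E :=
    Real.exp_le_exp.2 (mul_le_mul_of_nonneg_left (NNReal.coe_le_coe.2 hq1le) (by positivity))
  have hA' : |realFlowStop q.2 y q.1 - realFlowStop w₀ y q.1| < ε / 2 :=
    lt_of_le_of_lt (hA.trans (mul_le_mul_of_nonneg_left hexp_le hω0.le)) hωε
  rw [Real.dist_eq] at hq1 ⊢
  calc |realFlowStop q.2 y q.1 - realFlowStop w₀ y t₀|
      ≤ |realFlowStop q.2 y q.1 - realFlowStop w₀ y q.1| +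
          |realFlowStop w₀ y q.1 - realFlowStop w₀ y t₀| := abs_sub_le _ _ _
    _ < ε / 2 + ε / 2 := add_lt_add hA' hq1
    _ = ε := add_halves ε

end Loewner

end Literature.Probability.RandomPlanarGeometry

end
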